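import Literature.NumberTheory.NumberFields.BhargavaQuinticSpaceSection
import Literature.NumberTheory.NumberFields.BhargavaQuinticSpaceDescent
import Literature.FieldTheory.Separability.EtaleMonogenic
import Mathlib.RingTheory.AdjoinRoot
import HarnessLib

/-!
# Bhargava's quintic space: `K(A_f) ≃ k[T]/(f)` and part (c) of the Wright–Yukie fact

Support file for the named fact
`Literature.NumberTheory.NumberFields.BhargavaQuinticSpace.WrightYukie1992_orbit_bijective_etaleQuintic`
(file `BhargavaQuinticSpace.lean`).  Everything here is PROVED.

* `rootFunction`: the coordinate `θ = t₁/t₀` on `Z_{A_f}(k̄) = {[1 : θ : θ² : θ³] : f(θ) = 0}` is a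
  Galois-equivariant function, i.e. an element of `K(A_f)`, with `f(θ) = 0` (`aeval_rootFunction`);
* `sectionAlgEquiv : k[T]/(f) ≃ₐ[k] K(A_f)` for `f` a separable monic quintic (`T ↦ θ`; injective
  because a polynomial vanishing at the five roots is divisible by `f`, surjective by the dimension
  count `dim K(A_f) = 5` of part (a), `etale_and_finrank_of_isNondegenerate`);
* **`exists_isNondegenerate_algEquiv_of_etale` = part (c) of the fact**: every étale `k`-algebra of
  degree `5`, `char k = 0`, is `≃ K(A)` for a non-degenerate `A ∈ V(k)` — take `L ≃ k[T]/(f)`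
  (`Literature.FieldTheory.Separability.exists_adjoinRoot_algEquiv_of_etale`) and `A = A_f`.
  This is Wright–Yukie's "all such fields arise" [Yukie1993, §0.4] in the algebra form of
  Wright–Yukie–Kable (separable algebras of degree `5` are parametrised by non-degenerate rational
  orbits), via Bhargava's five points [Bhargava2008, §2].

## References

* M. Bhargava, *Higher composition laws IV*, Ann. of Math. 167 (2008), 53–94, §2. [Bhargava2008]
* A. Yukie, *Shintani Zeta Functions*, LMS LNS 183, CUP (1993), §0.4 Thm (0.4.2). [Yukie1993]
-/

noncomputable section

open Matrix Polynomial
open scoped LinearAlgebra.Projectivization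

namespace Literature.NumberTheory.NumberFields
namespace BhargavaQuinticSpace

universe u

/-! ### `K(A_f) ≃ₐ[k] k[T]/(f)` -/

section RootFunction

variable (k : Type u) [Field k]

/-- The affine coordinate `t₁/t₀` of a point of `ℙ³(k̄)` (junk value `0` on the plane `t₀ = 0`).
[folklore] -/
def ratio10 (p : ℙ (AlgebraicClosure k) (Fin 4 → AlgebraicClosure k)) : AlgebraicClosure k :=
  p.rep 1 / p.rep 0

/-- `ratio10 [v] = v₁ / v₀`. [folklore] -/
theorem ratio10_mk (v : Fin 4 → AlgebraicClosure k) (hv : v ≠ 0) :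
    ratio10 k (Projectivization.mk _ v hv) = v 1 / v 0 := by
  obtain ⟨a, ha⟩ := Projectivization.exists_smul_eq_mk_rep (AlgebraicClosure k) v hv
  rw [ratio10, ← ha]
  simp only [Pi.smul_apply, Units.smul_def, smul_eq_mul]
  exact mul_div_mul_left _ _ a.ne_zero

/-- `ratio10 [1 : θ : θ² : θ³] = θ`. [folklore] -/
theorem ratio10_twistedCubicProj (θ : AlgebraicClosure k) : ratio10 k (twistedCubicProj k θ) = θ := by
  rw [twistedCubicProj, ratio10_mk]
  simp

/-- `ratio10` is Galois-equivariant. [folklore] -/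
theorem ratio10_galAct (σ : AlgebraicClosure k ≃ₐ[k] AlgebraicClosure k)
    (p : ℙ (AlgebraicClosure k) (Fin 4 → AlgebraicClosure k)) :
    ratio10 k (galAct k σ p) = σ (ratio10 k p) := by
  induction p using Projectivization.ind with
  | h v hv =>
    rw [galAct_mk, ratio10_mk, ratio10_mk]
    simp [map_div₀]

/-- Evaluation of functions of `K(A)` at a point of the zero locus, a `k`-algebra map `K(A) → k̄`
(the geometric point of `Spec K(A)` indexed by `p`, [Bhargava2008, §2 pp. 59–60]). [folklore] -/
def evalPt (x : BhargavaQuinticSpace k) (p : geomZeroLocus k x) :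
    quinticAlgebraOf k x →ₐ[k] AlgebraicClosure k where
  toFun f := (f : geomZeroLocus k x → AlgebraicClosure k) p
  map_one' := rfl
  map_mul' _ _ := rfl
  map_zero' := rfl
  map_add' _ _ := rfl
  commutes' _ := rfl

/-- The ROOT FUNCTION `θ ∈ K(A_f)`: the coordinate `t₁/t₀` on `Z_{A_f} = {[1 : θ : θ² : θ³]}`,
a Galois-equivariant `k̄`-valued function on the zero locus. [folklore] -/
def rootFunction (a b c d e : k) : quinticAlgebraOf k (sectionQuintic a b c d e) :=
  ⟨fun p => ratio10 k p, by
    intro σ p q hpq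
    change ratio10 k (q : ℙ (AlgebraicClosure k) (Fin 4 → AlgebraicClosure k)) = σ (ratio10 k p)
    rw [← hpq, ratio10_galAct]⟩

/-- The value of the root function at `p` is `t₁/t₀ (p)`. [folklore] -/
theorem evalPt_rootFunction (a b c d e : k) (p : geomZeroLocus k (sectionQuintic a b c d e)) :
    evalPt k _ p (rootFunction k a b c d e) = ratio10 k p :=
  rfl

/-- The root function is a root of `f`: `f(θ) = 0` in `K(A_f)`. [folklore] -/
theorem aeval_rootFunction (a b c d e : k) :
    aeval (rootFunction k a b c d e) (quinticPoly a b c d e) = 0 := by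
  apply Subtype.ext
  funext p
  change evalPt k _ p (aeval (rootFunction k a b c d e) (quinticPoly a b c d e)) = 0
  rw [← Polynomial.aeval_algHom_apply, evalPt_rootFunction]
  have hp : (p : ℙ (AlgebraicClosure k) (Fin 4 → AlgebraicClosure k)) ∈
      twistedCubicProj k '' ((quinticPoly a b c d e).rootSet (AlgebraicClosure k)) := by
    rw [← geomZeroLocus_sectionQuintic]
    exact p.2
  obtain ⟨θ, hθ, hθp⟩ := hp
  rw [← hθp, ratio10_twistedCubicProj]
  exact ((Polynomial.mem_rootSet_of_ne (quinticPoly_ne_zero a b c d e)).mp hθ)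

/-- The `k`-algebra map `k[T]/(f) → K(A_f)`, `T ↦ θ`. [folklore] -/
def sectionAlgHom (a b c d e : k) :
    AdjoinRoot (quinticPoly a b c d e) →ₐ[k] quinticAlgebraOf k (sectionQuintic a b c d e) :=
  AdjoinRoot.liftAlgHom (quinticPoly a b c d e) (Algebra.ofId k _) (rootFunction k a b c d e)
    (by simpa [Polynomial.aeval_def] using aeval_rootFunction k a b c d e)

/-- `sectionAlgHom (g mod f) = g(θ)`. [folklore] -/
theorem sectionAlgHom_mk (a b c d e : k) (g : k[X]) :
    sectionAlgHom k a b c d e (AdjoinRoot.mk _ g) = aeval (rootFunction k a b c d e) g := by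
  rw [sectionAlgHom, AdjoinRoot.liftAlgHom_mk, Polynomial.aeval_def]
  rfl

/-- A polynomial vanishing at the root function is divisible by `f` (when `f` is separable):
`g(θ) = 0` at the five roots forces `f ∣ g` (reduce `g` mod `f`; a polynomial of degree `< 5`
with five roots vanishes). [folklore] -/
theorem quinticPoly_dvd_of_aeval_rootFunction_eq_zero (a b c d e : k)
    (hsep : (quinticPoly a b c d e).Separable) {g : k[X]}
    (hg : aeval (rootFunction k a b c d e) g = 0) : quinticPoly a b c d e ∣ g := by
  classical
  set f := quinticPoly a b c d e with hf
  have hmonic : f.Monic := by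
    rw [hf, quinticPoly]
    monicity!
  -- every root of `f` in `k̄` is a root of `g`
  have hroots : ∀ θ ∈ f.rootSet (AlgebraicClosure k), aeval θ g = 0 := by
    intro θ hθ
    have hp : twistedCubicProj k θ ∈ geomZeroLocus k (sectionQuintic a b c d e) := by
      rw [geomZeroLocus_sectionQuintic]
      exact ⟨θ, hθ, rfl⟩
    have := congrArg (fun F => evalPt k _ ⟨_, hp⟩ F) hg
    simp only [map_zero] at this
    rw [← Polynomial.aeval_algHom_apply, evalPt_rootFunction] at this
    simpa [ratio10_twistedCubicProj] using this
  -- reduce `g` modulo `f`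
  set r := g %ₘ f with hr
  have hr_roots : ∀ θ ∈ f.rootSet (AlgebraicClosure k), aeval θ r = 0 := by
    intro θ hθ
    have e1 := Polynomial.modByMonic_add_div g f
    have hfθ : aeval θ f = 0 := (Polynomial.mem_rootSet_of_ne (quinticPoly_ne_zero a b c d e)).mp hθ
    have := congrArg (aeval θ) e1
    rw [map_add, map_mul, hfθ, zero_mul, add_zero, hroots θ hθ] at this
    exact this
  have hr0 : r.map (algebraMap k (AlgebraicClosure k)) = 0 := by
    apply Polynomial.eq_zero_of_natDegree_lt_card_of_eval_eq_zero _ Subtype.val_injective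
      (ι := f.rootSet (AlgebraicClosure k))
    · rintro ⟨θ, hθ⟩
      rw [Polynomial.eval_map_algebraMap]
      exact hr_roots θ hθ
    · rw [Polynomial.card_rootSet_eq_natDegree hsep (IsAlgClosed.splits _), natDegree_quinticPoly,
        Polynomial.natDegree_map]
      by_cases hg0 : r = 0
      · rw [hg0, natDegree_zero]; norm_num
      · have hf1 : f ≠ 1 := by
          intro h1
          have := natDegree_quinticPoly a b c d e
          rw [← hf, h1, natDegree_one] at this
          exact absurd this (by norm_num)
        have := Polynomial.natDegree_modByMonic_lt g hmonic hf1
        rw [natDegree_quinticPoly] at this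
        exact this
  have hr0' : r = 0 := by
    rwa [Polynomial.map_eq_zero_iff (algebraMap k (AlgebraicClosure k)).injective] at hr0
  exact (Polynomial.modByMonic_eq_zero_iff_dvd hmonic).mp hr0'

/-- `k[T]/(f) → K(A_f)` is injective for separable `f`. [folklore] -/
theorem sectionAlgHom_injective (a b c d e : k) (hsep : (quinticPoly a b c d e).Separable) :
    Function.Injective (sectionAlgHom k a b c d e) := by
  rw [injective_iff_map_eq_zero]
  intro z hz
  induction z using AdjoinRoot.induction_on with
  | ih g =>
    rw [sectionAlgHom_mk] at hz
    exact AdjoinRoot.mk_eq_zero.mpr (quinticPoly_dvd_of_aeval_rootFunction_eq_zero k a b c d e hsep hz)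

/-- `dim_k k[T]/(f) = 5`. [folklore] -/
theorem finrank_adjoinRoot_quinticPoly (a b c d e : k) :
    Module.finrank k (AdjoinRoot (quinticPoly a b c d e)) = 5 := by
  rw [(AdjoinRoot.powerBasis (quinticPoly_ne_zero a b c d e)).finrank, AdjoinRoot.powerBasis_dim,
    natDegree_quinticPoly]

variable [CharZero k]

/-- `k[T]/(f) → K(A_f)` is bijective for separable `f` (`char k = 0`): injective, and both sides
have dimension `5` (part (a)). [folklore] -/
theorem sectionAlgHom_bijective (a b c d e : k) (hsep : (quinticPoly a b c d e).Separable) :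
    Function.Bijective (sectionAlgHom k a b c d e) := by
  have hinj := sectionAlgHom_injective k a b c d e hsep
  refine ⟨hinj, ?_⟩
  have h5 : Module.finrank k (quinticAlgebraOf k (sectionQuintic a b c d e)) = 5 :=
    (etale_and_finrank_of_isNondegenerate k (isNondegenerate_sectionQuintic k a b c d e hsep)).2
  haveI : Module.Finite k (quinticAlgebraOf k (sectionQuintic a b c d e)) :=
    Module.finite_of_finrank_pos (by rw [h5]; norm_num)
  haveI : Module.Finite k (AdjoinRoot (quinticPoly a b c d e)) :=
    Module.finite_of_finrank_pos (by rw [finrank_adjoinRoot_quinticPoly]; norm_num)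
  exact (LinearMap.injective_iff_surjective_of_finrank_eq_finrank
    (f := (sectionAlgHom k a b c d e).toLinearMap)
    (by rw [finrank_adjoinRoot_quinticPoly, h5])).mp hinj

/-- **`k[T]/(f) ≃ₐ[k] K(A_f)`** for a separable monic quintic `f` over a field of characteristic `0`:
the quintic algebra of the section `A_f` is the monogenic étale algebra defined by `f`.
[cite: Bhargava2008, §2 pp. 59–63; Yukie1993, §0.4] -/
def sectionAlgEquiv (a b c d e : k) (hsep : (quinticPoly a b c d e).Separable) :
    AdjoinRoot (quinticPoly a b c d e) ≃ₐ[k] quinticAlgebraOf k (sectionQuintic a b c d e) :=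
  AlgEquiv.ofBijective (sectionAlgHom k a b c d e) (sectionAlgHom_bijective k a b c d e hsep)

end RootFunction

/-! ### Part (c): every étale quintic algebra arises -/

section PartC

variable (k : Type u) [Field k]

/-- A monic quintic is `quinticPoly` of its coefficients. [folklore] -/
theorem eq_quinticPoly_of_monic_of_natDegree_eq_five {f : k[X]} (hmonic : f.Monic)
    (hdeg : f.natDegree = 5) :
    f = quinticPoly (f.coeff 4) (f.coeff 3) (f.coeff 2) (f.coeff 1) (f.coeff 0) := by
  have h5 : f.coeff 5 = 1 := by
    have := hmonic.leadingCoeff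
    rwa [Polynomial.leadingCoeff, hdeg] at this
  conv_lhs => rw [f.as_sum_range_C_mul_X_pow, hdeg]
  simp only [Finset.sum_range_succ, Finset.sum_range_zero, zero_add, pow_zero, mul_one, pow_one, h5,
    map_one, one_mul, quinticPoly]
  ring

variable [CharZero k]

/-- **Part (c) of `WrightYukie1992_orbit_bijective_etaleQuintic`.** Every étale `k`-algebra of degree
`5` (`char k = 0`) is isomorphic to `K(A)` for some non-degenerate `A ∈ V(k)` — namely `A = A_f` for
`L ≃ k[T]/(f)` (étale algebras over a field of characteristic `0` are monogenic).
[cite: Yukie1993, §0.4; Bhargava2008, §2] -/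
theorem exists_isNondegenerate_algEquiv_of_etale (L : Type u) [CommRing L] [Algebra k L]
    [Algebra.Etale k L] (h5 : Module.finrank k L = 5) :
    ∃ x : BhargavaQuinticSpace k, IsNondegenerate k x ∧ Nonempty (quinticAlgebraOf k x ≃ₐ[k] L) := by
  obtain ⟨f, hmonic, hsep, hdeg, ⟨e⟩⟩ :=
    Literature.FieldTheory.Separability.exists_adjoinRoot_algEquiv_of_etale k L
  rw [h5] at hdeg
  have hf := eq_quinticPoly_of_monic_of_natDegree_eq_five k hmonic hdeg
  rw [hf] at hsep e
  exact ⟨_, isNondegenerate_sectionQuintic k _ _ _ _ _ hsep,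
    ⟨(sectionAlgEquiv k _ _ _ _ _ hsep).symm.trans e⟩⟩

end PartC

end BhargavaQuinticSpace
end Literature.NumberTheory.NumberFields
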